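import Summits.Ventures.HodgeRepro.Night3GSetFormTwist
import Summits.Ventures.HodgeRepro.Night3GSetFormGram
import Summits.Ventures.HodgeRepro.Night3GSetFormSymm

/-!
# The conjugation of the eigen-coordinates and the form `H (x, y) = Q′ (x, C y)` on the Weil space

Blind re-derivation cell `pub-hodge-repro`, seat `night-3` (gen 7).  Imports gen 7's `Night3GSetFormTwist` (the
relabelling `relabelA`, the twisted coefficients `twistCoeff`, the twist-equivariance `Qc_relabelH_relabelH`), gen 5's
`Night3GSetFormGram` (the monomial Gram matrix `Qc_line_line_ne_zero_iff`) and gen 6's `Night3GSetFormSymm`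
(`Qc_isSymm_of_even`).  Namespace `HodgeRepro.Night3.GSetModel`.

THE OBJECTS (NIGHT3.md §14.3).  `C = conjH c n = relabelH n (Equiv.mulLeft c)` is the relabelling
`e_{(i,σ)} ↦ e_{(i,cσ)}` — the complex conjugation of `H^1` in eigen-coordinates, modelled `ℂ`-LINEARLY (the model has
no real structure, `K = L = ℂ`).  `C` permutes the lines, `C ℓ_τ = ℓ_{cτ}` (`conjH_line`), and is an involution
(`conjH_conjH`).  The CONJUGATION-FORM `Hc a (x, y) = Qc a (x, C y)` (`Hc`; on a real structure this is the Hermitian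
form of the polarisation on the Weil classes, here its `ℂ`-bilinear shadow).

THE STATEMENTS.  (i) **`Hc_line_line_ne_zero_iff`**: for `n ≥ 1` and non-vanishing coefficients,
`Hc a (ℓ_σ, ℓ_τ) ≠ 0 ⟺ τ = σ` — THE GRAM MATRIX OF `H` ON THE LINES IS DIAGONAL with non-zero diagonal (gen 5's
monomial Gram matrix read through `ℓ_τ ↦ ℓ_{cτ}`): the lines are an `H`-orthogonal family (`Hc_iIsOrtho`) of
non-isotropic vectors, hence linearly independent (`linearIndependent_line_of_Hc`, Mathlib's
`linearIndependent_of_iIsOrtho`) — an orthogonal basis of the Weil space `W = span (ℓ_σ)`.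
(ii) The twisted coefficients of the conjugation are `−a` on `Φ₀` (`twistCoeff_mulLeft`), so `Λc (a^c) = (−1)^{(m−1)n} Λc a`
(`Λc_twistCoeff_mulLeft`) and `Qc (a^c) = (−1)^{(m−1)n} Qc a` (`Qc_twistCoeff_mulLeft`); with gen 7's
twist-equivariance, **`Qc_conjH_conjH`**: `Qc a (C x, C y) = sign(E_c) · (−1)^{(m−1)n} · Qc a (x, y)`, and for EVEN
`n` (every zero-sum corner product) `C` is an ISOMETRY of `Qc a` (`Qc_conjH_conjH_of_even`).
(iii) For even `n` the conjugation-form is SYMMETRIC (`Hc_isSymm_of_even`: `Qc` symmetric by gen 6, `C` an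
isometric involution) and `Hc a (x, y) = Qc a (C x, y)` (`Hc_eq_Qc_conjH_left_of_even`).

NOT here: the SIGNATURE of `H` on the Weil space (the Hodge–Riemann bilinear relations) — not computable on a model
without a real structure; `Alg` (S4 IS `weilSpace M ≤ Alg M`), the cycle map, the `ℚ`-structure.  Nothing here
closes an open input of ROUTE.md; nothing here says anything about the status of the Hodge conjecture for CM abelian
varieties, which is NOT proved by anyone in this repository.
-/

set_option autoImplicit false
open Finset Module Function
open scoped Pointwise IsMulCommutative
namespace HodgeRepro.Night3.GSetModel

open HodgeRepro.CMHodgeOn ExteriorAlgebra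

/-! ### Composition of relabellings; the conjugation `C` -/

section Compose

variable {G : Type*}

/-- Relabellings compose: `relabelV n e ∘ relabelV n e' = relabelV n (e' ≫ e)`. -/
theorem relabelV_comp (n : ℕ) (e e' : G ≃ G) :
    (relabelV n e).toLinearMap ∘ₗ (relabelV n e').toLinearMap = (relabelV n (e'.trans e)).toLinearMap :=
  LinearMap.ext fun _ => funext fun _ => rfl

/-- The identity relabelling is the identity. -/
theorem relabelV_refl (n : ℕ) : (relabelV n (Equiv.refl G)).toLinearMap = LinearMap.id :=
  LinearMap.ext fun _ => funext fun _ => rfl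

/-- Relabellings compose on `⋀^n`: `relabelH n e (relabelH n e' x) = relabelH n (e' ≫ e) x`. -/
theorem relabelH_relabelH (n : ℕ) (e e' : G ≃ G) (x : Hn G n) :
    relabelH n e (relabelH n e' x) = relabelH n (e'.trans e) x := by
  rw [relabelH_apply, relabelH_apply, relabelH_apply, ← LinearMap.comp_apply, ← exteriorPower.map_comp,
    relabelV_comp]

/-- The identity relabelling is the identity on `⋀^n`. -/
theorem relabelH_refl (n : ℕ) (x : Hn G n) : relabelH n (Equiv.refl G) x = x := by
  rw [relabelH_apply, relabelV_refl, exteriorPower.map_id, LinearMap.id_apply]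

end Compose

section Conj

variable {G : Type*} [Group G]

/-- **The conjugation of the eigen-coordinates** `e_{(i,σ)} ↦ e_{(i,cσ)}` on `⋀^n ℂ^{Fin n × G}`: the relabelling by
the left multiplication `ρ ↦ cρ` (the `ℂ`-linear part of the complex conjugation of `H^1` in eigen-coordinates). -/
noncomputable def conjH (c : G) (n : ℕ) : Hn G n ≃ₗ[ℂ] Hn G n := relabelH n (Equiv.mulLeft c)

/-- `conjH` is the relabelling by `ρ ↦ cρ`. -/
theorem conjH_apply (c : G) (n : ℕ) (x : Hn G n) : conjH c n x = relabelH n (Equiv.mulLeft c) x := rfl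

/-- **The conjugation permutes the lines**: `C ℓ_τ = ℓ_{cτ}`. -/
theorem conjH_line [DecidableEq G] (c : G) (n : ℕ) (τ : G) : conjH c n (line n τ) = line n (c * τ) :=
  relabelH_line n (Equiv.mulLeft c) τ

/-- **The conjugation is an involution**: `C (C x) = x` (`c² = 1`). -/
theorem conjH_conjH {c : G} (hc : IsComplexConj c) (n : ℕ) (x : Hn G n) : conjH c n (conjH c n x) = x := by
  rw [conjH_apply, conjH_apply, relabelH_relabelH]
  have h : (Equiv.mulLeft c).trans (Equiv.mulLeft c) = Equiv.refl G :=
    Equiv.ext fun ρ => hc.mul_mul_cancel ρ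
  rw [h, relabelH_refl]

end Conj

/-! ### The conjugation-form `H (x, y) = Q′ (x, C y)` and its Gram matrix on the lines -/

section Form

variable {G : Type*} [Group G] [Fintype G] [DecidableEq G] [LinearOrder G]
variable {c : G} {Φ₀ : Finset G} {n : ℕ}

/-- **The conjugation-form** `Hc a (x, y) = Qc a (x, C y)` — the `ℂ`-bilinear shadow of the Hermitian form
`Q′ (x, ȳ)` of the polarisation on the Weil classes. -/
noncomputable def Hc (hc : IsComplexConj c) (hΦ : IsCMType c Φ₀) (a : Fin n → G → ℂ) :
    LinearMap.BilinForm ℂ (Hn G n) :=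
  (Qc hc hΦ a).compRight (conjH c n : Hn G n →ₗ[ℂ] Hn G n)

/-- `Hc` unfolded. -/
theorem Hc_apply (hc : IsComplexConj c) (hΦ : IsCMType c Φ₀) (a : Fin n → G → ℂ) (x y : Hn G n) :
    Hc hc hΦ a x y = Qc hc hΦ a x (conjH c n y) :=
  LinearMap.BilinForm.compRight_apply _ _ _ _

/-- `Hc` on the lines is `Qc` on the line and the conjugate line. -/
theorem Hc_line_line (hc : IsComplexConj c) (hΦ : IsCMType c Φ₀) (a : Fin n → G → ℂ) (σ τ : G) :
    Hc hc hΦ a (line n σ) (line n τ) = Qc hc hΦ a (line n σ) (line n (c * τ)) := by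
  rw [Hc_apply, conjH_line]

/-- **THE GRAM MATRIX OF `H` ON THE LINES IS DIAGONAL**: for `n ≥ 1` and non-vanishing coefficients,
`Hc a (ℓ_σ, ℓ_τ) ≠ 0 ⟺ τ = σ`. -/
theorem Hc_line_line_ne_zero_iff (hc : IsComplexConj c) (hΦ : IsCMType c Φ₀) (a : Fin n → G → ℂ)
    (ha : ∀ i ρ, ρ ∈ Φ₀ → a i ρ ≠ 0) (hn : 0 < n) (σ τ : G) :
    Hc hc hΦ a (line n σ) (line n τ) ≠ 0 ↔ τ = σ := by
  rw [Hc_line_line, Qc_line_line_ne_zero_iff hc hΦ a ha hn]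
  exact mul_right_inj c

/-- The off-diagonal entries vanish: `Hc a (ℓ_σ, ℓ_τ) = 0` for `τ ≠ σ` (`n ≥ 1`). -/
theorem Hc_line_line_eq_zero_of_ne (hc : IsComplexConj c) (hΦ : IsCMType c Φ₀) (a : Fin n → G → ℂ) (hn : 0 < n)
    {σ τ : G} (hτ : τ ≠ σ) : Hc hc hΦ a (line n σ) (line n τ) = 0 := by
  rw [Hc_line_line]
  exact Qc_line_line_eq_zero_of_ne hc hΦ a hn fun h => hτ (mul_left_cancel h)

/-- The diagonal entries are non-zero: `Hc a (ℓ_σ, ℓ_σ) = Qc a (ℓ_σ, ℓ_{cσ}) ≠ 0`. -/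
theorem Hc_line_line_self_ne_zero (hc : IsComplexConj c) (hΦ : IsCMType c Φ₀) (a : Fin n → G → ℂ)
    (ha : ∀ i ρ, ρ ∈ Φ₀ → a i ρ ≠ 0) (σ : G) : Hc hc hΦ a (line n σ) (line n σ) ≠ 0 := by
  rw [Hc_line_line]
  exact Qc_line_line_conj_ne_zero hc hΦ a ha σ

/-- **The lines are an `H`-orthogonal family** (`n ≥ 1`). -/
theorem Hc_iIsOrtho (hc : IsComplexConj c) (hΦ : IsCMType c Φ₀) (a : Fin n → G → ℂ) (hn : 0 < n) :
    (Hc hc hΦ a).iIsOrtho (line n) := by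
  rw [LinearMap.BilinForm.iIsOrtho_def]
  intro σ τ hστ
  exact Hc_line_line_eq_zero_of_ne hc hΦ a hn (Ne.symm hστ)

/-- **The lines are linearly independent, by orthogonality**: an `H`-orthogonal family of non-isotropic vectors
(Mathlib's `linearIndependent_of_iIsOrtho`) — the lines are an `H`-orthogonal basis of the Weil space
`W = span (ℓ_σ)`. -/
theorem linearIndependent_line_of_Hc (hc : IsComplexConj c) (hΦ : IsCMType c Φ₀) (a : Fin n → G → ℂ)
    (ha : ∀ i ρ, ρ ∈ Φ₀ → a i ρ ≠ 0) (hn : 0 < n) : LinearIndependent ℂ (line (G := G) n) :=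
  LinearMap.BilinForm.linearIndependent_of_iIsOrtho (Hc_iIsOrtho hc hΦ a hn) (Hc_line_line_self_ne_zero hc hΦ a ha)

end Form

/-! ### The twisted coefficients of the conjugation are `−a`; `C` is an isometry up to sign -/

section Sign

variable {G : Type*} [Group G] [Fintype G] [DecidableEq G] [LinearOrder G]
variable {c : G} {Φ₀ : Finset G} {n : ℕ}

omit [Fintype G] [LinearOrder G] in
/-- **The twisted coefficients of the conjugation are `−a` on the CM type**. -/
theorem twistCoeff_mulLeft (hc : IsComplexConj c) (hΦ : IsCMType c Φ₀) (a : Fin n → G → ℂ) (i : Fin n) {ρ : G}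
    (hρ : ρ ∈ Φ₀) : twistCoeff c Φ₀ (Equiv.mulLeft c) a i ρ = -a i ρ := by
  simp only [twistCoeff, Equiv.mulLeft_symm, Equiv.coe_mulLeft, hc.inv_eq, hc.mul_mul_cancel]
  rw [if_neg ((hΦ ρ).1 hρ), if_pos hρ, zero_sub]

omit [LinearOrder G] in
/-- The `(1,1)`-class with the conjugation-twisted coefficients is `(−1) •` the class. -/
theorem Lclass_twistCoeff_mulLeft (hc : IsComplexConj c) (hΦ : IsCMType c Φ₀) (a : Fin n → G → ℂ) (i : Fin n) :
    Lclass c Φ₀ (twistCoeff c Φ₀ (Equiv.mulLeft c) a) i = (-1 : ℂ) • Lclass c Φ₀ a i := by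
  rw [neg_one_smul, Lclass, Lclass, ← Finset.sum_neg_distrib]
  refine Finset.sum_congr rfl fun ρ hρ => ?_
  rw [twistCoeff_mulLeft hc hΦ a i hρ, neg_smul]

omit [LinearOrder G] in
/-- **Weil's class with the conjugation-twisted coefficients is `(−1)^{(m−1)n} •` Weil's class.** -/
theorem Λc_twistCoeff_mulLeft (hc : IsComplexConj c) (hΦ : IsCMType c Φ₀) (a : Fin n → G → ℂ) :
    Λc c Φ₀ (twistCoeff c Φ₀ (Equiv.mulLeft c) a) = ((-1 : ℂ) ^ ((Φ₀.card - 1) * n)) • Λc c Φ₀ a := by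
  rw [Λc, Λc]
  simp only [Lclass_twistCoeff_mulLeft hc hΦ a, Algebra.smul_def, mul_pow]
  rw [Finset.prod_mul_distrib, Finset.prod_const, Finset.card_univ, Fintype.card_fin, ← map_pow, ← map_pow,
    ← pow_mul]

omit [LinearOrder G] in
/-- The same, on the underlying elements of the exterior algebra. -/
theorem coe_Λc_twistCoeff_mulLeft (hc : IsComplexConj c) (hΦ : IsCMType c Φ₀) (a : Fin n → G → ℂ) :
    (Λc c Φ₀ (twistCoeff c Φ₀ (Equiv.mulLeft c) a) : ExteriorAlgebra ℂ (V G n)) =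
      ((-1 : ℂ) ^ ((Φ₀.card - 1) * n)) • (Λc c Φ₀ a : ExteriorAlgebra ℂ (V G n)) := by
  rw [Λc_twistCoeff_mulLeft hc hΦ a, Subalgebra.coe_smul]

/-- The form scales with Weil's class: if `Λc a' = r • Λc a` then `Qc a' = r • Qc a`. -/
theorem Qc_eq_mul_of_coe_Λc_eq_smul (hc : IsComplexConj c) (hΦ : IsCMType c Φ₀) (a a' : Fin n → G → ℂ) (r : ℂ)
    (h : (Λc c Φ₀ a' : ExteriorAlgebra ℂ (V G n)) = r • (Λc c Φ₀ a : ExteriorAlgebra ℂ (V G n))) (x y : Hn G n) :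
    Qc hc hΦ a' x y = r * Qc hc hΦ a x y := by
  rw [Qc_apply, Qc_apply, ← smul_eq_mul r, ← map_smul]
  congr 1
  apply Subtype.ext
  rw [Submodule.coe_smul]
  show (x : ExteriorAlgebra ℂ (V G n)) * y * Λc c Φ₀ a' = r • ((x : ExteriorAlgebra ℂ (V G n)) * y * Λc c Φ₀ a)
  rw [h, mul_smul_comm]

/-- **The form with the conjugation-twisted coefficients is `(−1)^{(m−1)n}` times the form.** -/
theorem Qc_twistCoeff_mulLeft (hc : IsComplexConj c) (hΦ : IsCMType c Φ₀) (a : Fin n → G → ℂ) (x y : Hn G n) :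
    Qc hc hΦ (twistCoeff c Φ₀ (Equiv.mulLeft c) a) x y = (-1 : ℂ) ^ ((Φ₀.card - 1) * n) * Qc hc hΦ a x y :=
  Qc_eq_mul_of_coe_Λc_eq_smul hc hΦ a _ _ (coe_Λc_twistCoeff_mulLeft hc hΦ a) x y

/-- **THE CONJUGATION IS AN ISOMETRY OF `Q′` UP TO AN EXPLICIT SIGN**:
`Qc a (C x, C y) = sign(E_c) · (−1)^{(m−1)n} · Qc a (x, y)` (gen 7's twist-equivariance with `a ↦ a^c = −a`). -/
theorem Qc_conjH_conjH (hc : IsComplexConj c) (hΦ : IsCMType c Φ₀) (a : Fin n → G → ℂ) (x y : Hn G n) :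
    Qc hc hΦ a (conjH c n x) (conjH c n y) =
      ((Equiv.Perm.sign (relabelPerm n (Equiv.mulLeft c)) : ℤ) : ℂ) * (-1 : ℂ) ^ ((Φ₀.card - 1) * n) *
        Qc hc hΦ a x y := by
  have h := Qc_conj hc hΦ a x y
  rw [Qc_twistCoeff_mulLeft hc hΦ a] at h
  have hu : (-1 : ℂ) ^ ((Φ₀.card - 1) * n) * (-1 : ℂ) ^ ((Φ₀.card - 1) * n) = 1 := by
    rw [← pow_add, ← two_mul, pow_mul, neg_one_sq, one_pow]
  calc Qc hc hΦ a (conjH c n x) (conjH c n y)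
      = ((-1 : ℂ) ^ ((Φ₀.card - 1) * n) * (-1 : ℂ) ^ ((Φ₀.card - 1) * n)) *
          Qc hc hΦ a (conjH c n x) (conjH c n y) := by rw [hu, one_mul]
    _ = (-1 : ℂ) ^ ((Φ₀.card - 1) * n) *
          ((-1 : ℂ) ^ ((Φ₀.card - 1) * n) * Qc hc hΦ a (relabelH n (Equiv.mulLeft c) x)
            (relabelH n (Equiv.mulLeft c) y)) := by rw [mul_assoc, conjH_apply, conjH_apply]
    _ = (-1 : ℂ) ^ ((Φ₀.card - 1) * n) *
          (((Equiv.Perm.sign (relabelPerm n (Equiv.mulLeft c)) : ℤ) : ℂ) * Qc hc hΦ a x y) := by rw [h]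
    _ = _ := by ring

/-- **For even `n` the conjugation is an isometry of `Q′`**: `Qc a (C x, C y) = Qc a (x, y)` (every zero-sum corner
product has an even number of factors). -/
theorem Qc_conjH_conjH_of_even (hc : IsComplexConj c) (hΦ : IsCMType c Φ₀) (hn : Even n) (a : Fin n → G → ℂ)
    (x y : Hn G n) : Qc hc hΦ a (conjH c n x) (conjH c n y) = Qc hc hΦ a x y := by
  rw [Qc_conjH_conjH hc hΦ a x y, sign_relabelPerm_of_even n hn, one_mul, (hn.mul_left _).neg_one_pow, one_mul]

/-- **For even `n` the conjugation-form is `Q′ (C x, y)`**: `Hc a (x, y) = Qc a (C x, y)`. -/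
theorem Hc_eq_Qc_conjH_left_of_even (hc : IsComplexConj c) (hΦ : IsCMType c Φ₀) (hn : Even n) (a : Fin n → G → ℂ)
    (x y : Hn G n) : Hc hc hΦ a x y = Qc hc hΦ a (conjH c n x) y := by
  rw [Hc_apply]
  conv_rhs => rw [← conjH_conjH hc n y]
  rw [Qc_conjH_conjH_of_even hc hΦ hn]

/-- **For even `n` the conjugation-form is SYMMETRIC** (`Q′` symmetric by gen 6, `C` an isometric involution). -/
theorem Hc_isSymm_of_even (hc : IsComplexConj c) (hΦ : IsCMType c Φ₀) (hn : Even n) (a : Fin n → G → ℂ) :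
    (Hc hc hΦ a).IsSymm := by
  refine ⟨fun x y => ?_⟩
  rw [Hc_eq_Qc_conjH_left_of_even hc hΦ hn, Hc_apply]
  exact (Qc_isSymm_of_even hc hΦ a hn).eq _ _

end Sign

end HodgeRepro.Night3.GSetModel
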